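import Summits.CriticalPhenomena.Ising3DConformalLimit.Theses.EnergyNotSigmaSquared

/-!
# CriticalPhenomena / Ising3DConformalLimit — route `EnergyNotSigmaSquared`, assembly

Settles item `stmt-CriticalPhenomena-4474` (assembly of route `EnergyNotSigmaSquared`, rank 1):
`EnergyGapPowerLaw → GapForcesFarMerging → FarMergingGivesU4 → MoebiusLimit → Ising3DConformalLimit`.

Pure logic. `MoebiusLimit` supplies a non-degenerate pointwise scaling limit `(ρ, Δ, S)` of the
critical Ising correlators on `ℤ³` that is Möbius covariant with dimension `Δ` — the conjunct
`Ising3DConformalLimit` minus its clause `HasNontrivialU4 S`. `GapForcesFarMerging` applied to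
`EnergyGapPowerLaw` gives far merging (`U₄ ≤ -c ⟨σσ⟩⟨σσ⟩`) along infinitely many dilations of a
fixed injective lattice quadruple, and `FarMergingGivesU4` turns far merging into
`HasNontrivialU4 S` for every non-degenerate pointwise limit `(ρ, S)`, in particular for the
Möbius-covariant one. This is the route's deciding theorem
`Summit.CriticalPhenomena.Ising3DConformalLimit.Theses.EnergyNotSigmaSquared.closes` restated as the
item `Assembly`; nothing else is used (no named facts, unconditional).

What is NOT here: any of the four hypotheses (items `stmt-CriticalPhenomena-4469` GAP,
`-4468` TRANSFER, `-4471` GLUE, `-1344` ML), which carry all the mathematics of the route.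
-/

namespace Summit.CriticalPhenomena.Ising3DConformalLimit.Theorems

/-- Settles `stmt-CriticalPhenomena-4474` (exact signature of
`Theses.EnergyNotSigmaSquared.Assembly`): the assembly
`EnergyGapPowerLaw → GapForcesFarMerging → FarMergingGivesU4 → MoebiusLimit → Ising3DConformalLimit`
of route `EnergyNotSigmaSquared`. Proof: unfold; the Möbius-covariant non-degenerate limit
`(ρ, Δ, S)` given by `MoebiusLimit` is the witness for `Ising3DConformalLimit`, and its one missing
clause `HasNontrivialU4 S` is `FarMergingGivesU4 (GapForcesFarMerging EnergyGapPowerLaw) ρ S`.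
[folklore] -/
theorem Assembly_proof :
    Summit.CriticalPhenomena.Ising3DConformalLimit.Theses.EnergyNotSigmaSquared.Assembly := by
  unfold Summit.CriticalPhenomena.Ising3DConformalLimit.Theses.EnergyNotSigmaSquared.Assembly
  intro hGap hTransfer hGlue hML
  obtain ⟨ρ, Δ, S, hρ, hΔ, hlim, hnd, hmob⟩ := hML
  exact ⟨ρ, Δ, S, hρ, hΔ, hlim, hnd, hmob, hGlue (hTransfer hGap) ρ S hρ hlim hnd⟩

end Summit.CriticalPhenomena.Ising3DConformalLimit.Theorems
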